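import Summits.CriticalPhenomena.PercolationContinuityZ3.Theorems.PercNearOneGluingNoHeavyLowerTailSunflowerChainOnePetal

/-!
# The chain certificate for (RES0′) — explicit exponents

(prove-1 gen 56, memo run/shared/lean/prim/prim-ineq-prove-1/FINDING-CHAIN-prove1-g56.md.)  `res0_of_chain_certificate_explicit`: the theorem
`res0_of_chain_certificate` with the chain exponents written out, `λ_h = log(G(hp)/g)/log(1/α₁₁)`, `λ_k = log(G(Hhub)/G(hp))/log(1/α₀₁)`,
`λ_y = log(a/G(Hhub))/log(1/α₀₀)` (floors `< 1`): the ONLY hypotheses beyond the parameter ranges and `c₀ ≥ τσ` are the three scalar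
kink-dwarf inequalities (Da), (Db), (Dc); conclusion: (RES0′) `∏_j G_j ≤ g^(n−1)·a` for every number of petals from the three cell budgets. [this work]
-/

namespace Summit.CriticalPhenomena.PercolationContinuityZ3.Theorems.SunflowerPartition.SafeCalc.LinkedCurrency

open Finset
/-- A positive real to the power `log v / log b` (base `b > 0`, `b ≠ 1`) is `v`: `b ^ (log v / log b) = v` for `v > 0`. -/
theorem rpow_log_div_log {b v : ℝ} (hb : 0 < b) (hb1 : b ≠ 1) (hv : 0 < v) : b ^ (Real.log v / Real.log b) = v := by
  have hlb : Real.log b ≠ 0 := Real.log_ne_zero_of_pos_of_ne_one hb hb1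
  rw [Real.rpow_def_of_pos hb, mul_div_cancel₀ _ hlb, Real.exp_log hv]

set_option maxHeartbeats 800000 in
/-- **(RES0′) for every number of petals from the chain certificate, explicit form.**  With the chain exponents written out as
`λ_h = log(G(hp)/g)/log(1/α₁₁)`, `λ_k = log(G(Hhub)/G(hp))/log(1/α₀₁)`, `λ_y = log(a/G(Hhub))/log(1/α₀₀)` (floors `< 1`), the only
hypotheses beyond the parameter ranges and `c₀ ≥ τσ` are the three kink-dwarf inequalities (Da), (Db), (Dc). [this work] -/
theorem res0_of_chain_certificate_explicit {κ : Type*} [DecidableEq κ] {τ σ s α00 α01 α11 c0 : ℝ} (hτ0 : 0 < τ) (hτ1 : τ < 1)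
    (hσ0 : 0 ≤ σ) (hσ1 : σ < 1) (hs0 : 0 ≤ s) (hs1 : s ≤ 1) (hα00 : 0 < α00) (h01 : α00 ≤ α01) (h11 : α01 ≤ α11) (hα1 : α11 < 1)
    (hc0 : τ * σ ≤ c0)
    (Da : (c0 + τ * (1 - σ) * ((1 - s) * α01 + s * α01) + s * (1 - τ) * ((1 - σ) * α01 + σ * α11)) ≤ (c0 + τ * (1 - σ) * ((1 - s) * α00 + s * α01) + s * (1 - τ) * ((1 - σ) * α01 + σ * α11)) * (α01 / α00) ^ (Real.log ((c0 + τ * (1 - σ) * ((1 - s) * 1 + s * 1) + s * (1 - τ) * ((1 - σ) * 1 + σ * 1)) / (c0 + τ * (1 - σ) * ((1 - s) * α00 + s * 1) + s * (1 - τ) * ((1 - σ) * 1 + σ * 1))) / Real.log (1 / α00)))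
    (Db : (c0 + τ * (1 - σ) * ((1 - s) * α00 + s * α11) + s * (1 - τ) * ((1 - σ) * α11 + σ * α11)) ≤ (c0 + τ * (1 - σ) * ((1 - s) * α00 + s * α01) + s * (1 - τ) * ((1 - σ) * α01 + σ * α11)) * (α11 / α01) ^ (Real.log ((c0 + τ * (1 - σ) * ((1 - s) * α00 + s * 1) + s * (1 - τ) * ((1 - σ) * 1 + σ * 1)) / (c0 + τ * (1 - σ) * ((1 - s) * α00 + s * α01) + s * (1 - τ) * ((1 - σ) * α01 + σ * 1))) / Real.log (1 / α01)))
    (Dc : (c0 + τ * (1 - σ) * ((1 - s) * α11 + s * α11) + s * (1 - τ) * ((1 - σ) * α11 + σ * α11)) ≤ (c0 + τ * (1 - σ) * ((1 - s) * α00 + s * α01) + s * (1 - τ) * ((1 - σ) * α01 + σ * α11)) * (α11 / α00) ^ (Real.log ((c0 + τ * (1 - σ) * ((1 - s) * 1 + s * 1) + s * (1 - τ) * ((1 - σ) * 1 + σ * 1)) / (c0 + τ * (1 - σ) * ((1 - s) * α00 + s * 1) + s * (1 - τ) * ((1 - σ) * 1 + σ * 1))) / Real.log (1 / α00)) * (α11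 / α01) ^ (Real.log ((c0 + τ * (1 - σ) * ((1 - s) * α00 + s * 1) + s * (1 - τ) * ((1 - σ) * 1 + σ * 1)) / (c0 + τ * (1 - σ) * ((1 - s) * α00 + s * α01) + s * (1 - τ) * ((1 - σ) * α01 + σ * 1))) / Real.log (1 / α01)))
    (S : Finset κ) (hS : S.Nonempty) (y k gc h : κ → ℝ)
    (hy : ∀ j ∈ S, α00 ≤ y j) (hyk : ∀ j ∈ S, y j ≤ k j) (hk1 : ∀ j ∈ S, k j ≤ 1) (hg : ∀ j ∈ S, α01 ≤ gc j)
    (hgk : ∀ j ∈ S, gc j ≤ k j) (hgh : ∀ j ∈ S, gc j ≤ h j) (hh : ∀ j ∈ S, α11 ≤ h j) (hh1 : ∀ j ∈ S, h j ≤ 1)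
    (hBy : ∏ j ∈ S, y j ≤ α00 ^ (S.card - 1)) (hBk : ∏ j ∈ S, k j ≤ α01 ^ (S.card - 1)) (hBh : ∏ j ∈ S, h j ≤ α11 ^ (S.card - 1)) :
    ∏ j ∈ S, (c0 + τ * (1 - σ) * ((1 - s) * y j + s * k j) + s * (1 - τ) * ((1 - σ) * gc j + σ * h j)) ≤ (c0 + τ * (1 - σ) * ((1 - s) * α00 + s * α01) + s * (1 - τ) * ((1 - σ) * α01 + σ * α11)) ^ (S.card - 1) * (c0 + τ * (1 - σ) * ((1 - s) * 1 + s * 1) + s * (1 - τ) * ((1 - σ) * 1 + σ * 1)) := by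
  have hα01 : 0 < α01 := lt_of_lt_of_le hα00 h01
  have hα11 : 0 < α11 := lt_of_lt_of_le hα01 h11
  have h1σ : 0 ≤ 1 - σ := sub_nonneg.2 hσ1.le
  have h1s : 0 ≤ 1 - s := sub_nonneg.2 hs1
  have h1τ : 0 ≤ 1 - τ := sub_nonneg.2 hτ1.le
  -- positivity of the chain values g ≤ G(hp) ≤ G(Hhub) ≤ a
  obtain ⟨g, hgd⟩ : ∃ t : ℝ, t = (c0 + τ * (1 - σ) * ((1 - s) * α00 + s * α01) + s * (1 - τ) * ((1 - σ) * α01 + σ * α11)) := ⟨_, rfl⟩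
  obtain ⟨vp, hvp⟩ : ∃ t : ℝ, t = (c0 + τ * (1 - σ) * ((1 - s) * α00 + s * α01) + s * (1 - τ) * ((1 - σ) * α01 + σ * 1)) := ⟨_, rfl⟩
  obtain ⟨vH, hvH⟩ : ∃ t : ℝ, t = (c0 + τ * (1 - σ) * ((1 - s) * α00 + s * 1) + s * (1 - τ) * ((1 - σ) * 1 + σ * 1)) := ⟨_, rfl⟩
  obtain ⟨vF, hvF⟩ : ∃ t : ℝ, t = (c0 + τ * (1 - σ) * ((1 - s) * 1 + s * 1) + s * (1 - τ) * ((1 - σ) * 1 + σ * 1)) := ⟨_, rfl⟩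
  have hg0 : 0 < g := by
    rw [hgd]
    have t1 : 0 < τ * (1 - σ) * ((1 - s) * α00 + s * α01) := by
      apply mul_pos (mul_pos hτ0 (sub_pos.2 hσ1)); nlinarith [mul_nonneg hs0 (sub_nonneg.2 h01)]
    have t2 : 0 ≤ s * (1 - τ) * ((1 - σ) * α01 + σ * α11) := mul_nonneg (mul_nonneg hs0 h1τ) (by nlinarith [mul_nonneg hσ0 hα11.le])
    nlinarith [mul_nonneg hτ0.le hσ0]
  have d1 : vp = g + s * (1 - τ) * σ * (1 - α11) := by rw [hvp, hgd]; ring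
  have d2 : vH = vp + (τ * (1 - σ) * s + s * (1 - τ) * (1 - σ)) * (1 - α01) := by rw [hvH, hvp]; ring
  have d3 : vF = vH + τ * (1 - σ) * (1 - s) * (1 - α00) := by rw [hvF, hvH]; ring
  have hvp0 : 0 < vp := by
    rw [d1]; exact add_pos_of_pos_of_nonneg hg0 (mul_nonneg (mul_nonneg (mul_nonneg hs0 h1τ) hσ0) (sub_nonneg.2 hα1.le))
  have hvH0 : 0 < vH := by
    rw [d2]; exact add_pos_of_pos_of_nonneg hvp0 (mul_nonneg (add_nonneg (mul_nonneg (mul_nonneg hτ0.le h1σ) hs0)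
      (mul_nonneg (mul_nonneg hs0 h1τ) h1σ)) (sub_nonneg.2 (h11.trans hα1.le)))
  have hvF0 : 0 < vF := by
    rw [d3]; exact add_pos_of_pos_of_nonneg hvH0 (mul_nonneg (mul_nonneg (mul_nonneg hτ0.le h1σ) h1s) (sub_nonneg.2 ((h01.trans h11).trans hα1.le)))
  -- the exponents are nonnegative and solve the chain equations
  have hb11 : 1 < 1 / α11 := by rw [lt_div_iff₀ hα11]; linarith
  have hb01 : 1 < 1 / α01 := by rw [lt_div_iff₀ hα01]; linarith [h11.trans_lt hα1]
  have hb00 : 1 < 1 / α00 := by rw [lt_div_iff₀ hα00]; linarith [(h01.trans h11).trans_lt hα1]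
  have nn : ∀ {b u v : ℝ}, 1 < b → 0 < u → u ≤ v → 0 ≤ Real.log (v / u) / Real.log b := fun hb hu huv =>
    div_nonneg (Real.log_nonneg (by rw [le_div_iff₀ hu]; linarith)) (Real.log_pos hb).le
  have hlh : 0 ≤ Real.log (vp / g) / Real.log (1 / α11) := nn hb11 hg0 (by rw [d1]; linarith [mul_nonneg (mul_nonneg (mul_nonneg hs0 h1τ) hσ0) (sub_nonneg.2 hα1.le)])
  have hlk : 0 ≤ Real.log (vH / vp) / Real.log (1 / α01) := nn hb01 hvp0 (by
    rw [d2]; linarith [mul_nonneg (add_nonneg (mul_nonneg (mul_nonneg hτ0.le h1σ) hs0) (mul_nonneg (mul_nonneg hs0 h1τ) h1σ)) (sub_nonneg.2 (h11.trans hα1.le))])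
  have hly : 0 ≤ Real.log (vF / vH) / Real.log (1 / α00) := nn hb00 hvH0 (by
    rw [d3]; linarith [mul_nonneg (mul_nonneg (mul_nonneg hτ0.le h1σ) h1s) (sub_nonneg.2 ((h01.trans h11).trans hα1.le))])
  have Eh : vp = g * (1 / α11) ^ (Real.log (vp / g) / Real.log (1 / α11)) := by
    rw [rpow_log_div_log (by positivity) hb11.ne' (div_pos hvp0 hg0)]; field_simp
  have EH : vH = g * (1 / α01) ^ (Real.log (vH / vp) / Real.log (1 / α01)) * (1 / α11) ^ (Real.log (vp / g) / Real.log (1 / α11)) := by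
    rw [rpow_log_div_log (by positivity) hb01.ne' (div_pos hvH0 hvp0), rpow_log_div_log (by positivity) hb11.ne' (div_pos hvp0 hg0)]
    field_simp
  have Ef : vF = g * (1 / α00) ^ (Real.log (vF / vH) / Real.log (1 / α00)) * (1 / α01) ^ (Real.log (vH / vp) / Real.log (1 / α01)) *
      (1 / α11) ^ (Real.log (vp / g) / Real.log (1 / α11)) := by
    rw [rpow_log_div_log (by positivity) hb00.ne' (div_pos hvF0 hvH0), rpow_log_div_log (by positivity) hb01.ne' (div_pos hvH0 hvp0),
      rpow_log_div_log (by positivity) hb11.ne' (div_pos hvp0 hg0)]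
    field_simp
  rw [hvp, hgd] at Eh hlh; rw [hvH, hvp, hgd] at EH; rw [hvF, hvH, hvp, hgd] at Ef; rw [hvH, hvp] at hlk; rw [hvF, hvH] at hly
  exact res0_of_chain_certificate hτ0 hτ1 hσ0 hσ1 hs0 hs1 hα00 h01 h11 hα1.le hc0 hly hlk hlh Eh EH Ef Da Db Dc S hS y k gc h
    hy hyk hk1 hg hgk hgh hh hh1 hBy hBk hBh


/-- **Corollary (equal floors): (RES0′) for every number of petals, unconditionally.**  When the three floors coincide
(`α₀₀ = α₀₁ = α₁₁ = f ∈ (0,1)`) the kink dwarfs ARE the floor petal, so (Da), (Db), (Dc) are trivial and the chain certificate proves the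
two-linked-systems inequality for every `τ ∈ (0,1)`, `σ ∈ [0,1)`, `s ∈ [0,1]`, every `c₀ ≥ τσ` and every family obeying the three cell budgets. [this work] -/
theorem res0_equal_floors {κ : Type*} [DecidableEq κ] {τ σ s f c0 : ℝ} (hτ0 : 0 < τ) (hτ1 : τ < 1) (hσ0 : 0 ≤ σ) (hσ1 : σ < 1)
    (hs0 : 0 ≤ s) (hs1 : s ≤ 1) (hf0 : 0 < f) (hf1 : f < 1) (hc0 : τ * σ ≤ c0)
    (S : Finset κ) (hS : S.Nonempty) (y k gc h : κ → ℝ)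
    (hy : ∀ j ∈ S, f ≤ y j) (hyk : ∀ j ∈ S, y j ≤ k j) (hk1 : ∀ j ∈ S, k j ≤ 1) (hg : ∀ j ∈ S, f ≤ gc j)
    (hgk : ∀ j ∈ S, gc j ≤ k j) (hgh : ∀ j ∈ S, gc j ≤ h j) (hh : ∀ j ∈ S, f ≤ h j) (hh1 : ∀ j ∈ S, h j ≤ 1)
    (hBy : ∏ j ∈ S, y j ≤ f ^ (S.card - 1)) (hBk : ∏ j ∈ S, k j ≤ f ^ (S.card - 1)) (hBh : ∏ j ∈ S, h j ≤ f ^ (S.card - 1)) :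
    ∏ j ∈ S, (c0 + τ * (1 - σ) * ((1 - s) * y j + s * k j) + s * (1 - τ) * ((1 - σ) * gc j + σ * h j)) ≤ (c0 + τ * (1 - σ) * ((1 - s) * f + s * f) + s * (1 - τ) * ((1 - σ) * f + σ * f)) ^ (S.card - 1) * (c0 + τ * (1 - σ) * ((1 - s) * 1 + s * 1) + s * (1 - τ) * ((1 - σ) * 1 + σ * 1)) := by
  have hff : (f / f : ℝ) = 1 := div_self (ne_of_gt hf0)
  refine res0_of_chain_certificate_explicit hτ0 hτ1 hσ0 hσ1 hs0 hs1 hf0 le_rfl le_rfl hf1 hc0 ?_ ?_ ?_ S hS y k gc h hy hyk hk1 hg hgk hgh hh hh1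
    hBy hBk hBh
  · rw [hff, Real.one_rpow, mul_one]
  · rw [hff, Real.one_rpow, mul_one]
  · rw [hff, Real.one_rpow, Real.one_rpow, mul_one, mul_one]

end Summit.CriticalPhenomena.PercolationContinuityZ3.Theorems.SunflowerPartition.SafeCalc.LinkedCurrency
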